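import Literature.RingTheory.SymmetricFunctions.LittlewoodIdentity
import Literature.RingTheory.SymmetricFunctions.CauchyIdentityAnalytic
import HarnessLib

/-!
# Littlewood's identity, analytic form: absolutely convergent Schur and Pieri-solution series

Topic `RingTheory/SymmetricFunctions`; namespace
`Literature.RingTheory.SymmetricFunctions.SymmPoly`. Sequel to `LittlewoodIdentity` (the formal
identity `(∑_λ s_λ(x) T^{|λ|}) · ∏_i (1 - x_i T) ∏_{i<j} (1 - x_i x_j T²) = 1` in `R⟦T⟧`,
Macdonald 1995, Ch. I §5 Example 4) in the style of `CauchyIdentityAnalytic`: the formal identity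
is turned into absolutely convergent sums over a complete normed field `𝕜` (everything proved,
Mathlib + the two files only; no named fact, no instance).

* `geomSq c = ∑_m c^m T^{2m}`, `geomSq_mul_one_sub` (`· (1 - c T²) = 1`), `rescale_geomSq`,
  `summable_norm_coeff_geomSq_and_hasSum` (sum `(1 - c)⁻¹` for `‖c‖ < 1`);
* `littlewoodSeries_eq_prod_geom`: `∑_λ s_λ(x) T^{|λ|} = ∏_i (∑_m x_i^m T^m) ·
  ∏_{i<j} (∑_m (x_i x_j)^m T^{2m})` in `R⟦T⟧`;
* `hasSum_coeff_littlewoodSeries_mul_pow` (**Littlewood's identity, analytic**): for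
  `‖x_i t‖ < 1` (all `i`), `∑_N (∑_{λ antitone, |λ| = N} s_λ(x)) t^N = ∏_i (1 - x_i t)⁻¹
  ∏_{i<j} (1 - x_i x_j t²)⁻¹`, absolutely (`summable_norm_coeff_littlewoodSeries_mul_pow`);
* `mk_sum_eq_C_mul_littlewoodSeries`, `hasSum_littlewoodPieri`, `summable_norm_littlewoodPieri`:
  for a solution `w` of the dual Pieri recursions for `x` (vanishing off the antitone weights;
  `eq_schur_smul_of_pieri`), `∑_N (∑_{|m| = N} w(m)) t^N = w(0) ∏_i (1 - x_i t)⁻¹ ∏_{i<j}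
  (1 - x_i x_j t²)⁻¹` for `‖x_i t‖ < 1`. With `x` the Satake parameters of an unramified
  representation of `GL_n(E_w)`, `E_w/F_v` the unramified quadratic extension of
  non-archimedean local fields (`q_w = q_v²`), `t = q_v^{-s}` and `w` the spherical Whittaker
  function on the dominant torus elements `ϖ_v^λ` normalised by `q_v^{b(λ)} = δ_{B(F_v)}(ϖ^λ)⁻¹`
  (which is Shintani's normalisation `q_w^{b(λ)/2}` for `GL_n(E_w)`), this is the value
  `W(1) ∏_i (1 - x_i q_v^{-s})⁻¹ ∏_{i<j} (1 - x_i x_j q_v^{-2s})⁻¹ = W(1) L(s, π_v, As)` of the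
  unramified local Asai (twisted tensor) integral `∫_{N\GL_n(F_v)} W(g) Φ°(e_n g) |det g|^s dg`
  at an inert place (Flicker 1988, §3 Proposition, p. 306) *after* the `p`-adic integral has
  been unfolded to the torus sum — the unfolding is not in this file.

## References

* I. G. Macdonald, *Symmetric Functions and Hall Polynomials*, 2nd ed. (1995), Ch. I §5 Ex. 4.
  [Macdonald1995]
* Y. Z. Flicker, *Twisted tensors and Euler products*, Bull. Soc. Math. France 116 (1988),
  295–313, §3 Proposition. [Flicker1988]
* T. Shintani, Proc. Japan Acad. 52 (1976), 180–182.
-/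

noncomputable section


namespace Literature.RingTheory.SymmetricFunctions.SymmPoly

open Finset PowerSeries

section GeomSq

variable {R : Type*} [CommRing R]

/-- The geometric series in `T²`: `geomSq c = ∑_m c^m T^{2m}`. [folklore] -/
def geomSq (c : R) : R⟦X⟧ := PowerSeries.mk fun N => if Even N then c ^ (N / 2) else 0

/-- Coefficients of `geomSq`. [folklore] -/
@[simp] theorem coeff_geomSq (c : R) (N : ℕ) :
    coeff N (geomSq c) = if Even N then c ^ (N / 2) else 0 := by
  rw [geomSq, coeff_mk]

/-- `(∑_m c^m T^{2m}) · (1 - c T²) = 1`. [folklore] -/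
theorem geomSq_mul_one_sub (c : R) : geomSq c * (1 - C c * X ^ 2) = 1 := by
  ext N
  rw [mul_sub, mul_one, map_sub, show geomSq c * (C c * X ^ 2) = X ^ 2 * (C c * geomSq c) by ring,
    PowerSeries.coeff_X_pow_mul', PowerSeries.coeff_one, coeff_geomSq]
  rcases Nat.even_or_odd N with ⟨k, rfl⟩ | ⟨k, rfl⟩
  · rcases Nat.eq_zero_or_pos k with rfl | hk
    · simp
    · have h2 : 2 ≤ k + k := by omega
      have hne : k + k ≠ 0 := by omega
      rw [if_pos ⟨k, rfl⟩, if_pos h2, if_neg hne, PowerSeries.coeff_C_mul, coeff_geomSq,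
        if_pos ⟨k - 1, by omega⟩]
      have e1 : (k + k) / 2 = k := by omega
      have e2 : (k + k - 2) / 2 = k - 1 := by omega
      rw [e1, e2, ← pow_succ', Nat.sub_add_cancel hk, sub_self]
  · have hodd : ¬ Even (2 * k + 1) := Nat.not_even_iff_odd.mpr ⟨k, rfl⟩
    rw [if_neg hodd, if_neg (by omega : (2 * k + 1) ≠ 0)]
    split_ifs with h2
    · rw [PowerSeries.coeff_C_mul, coeff_geomSq, if_neg, mul_zero, sub_zero]
      rintro ⟨j, hj⟩
      omega
    · rw [sub_zero]

/-- Rescaling: `∑_m c^m (tT)^{2m} = ∑_m (c t²)^m T^{2m}`. [folklore] -/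
theorem rescale_geomSq (c t : R) : rescale t (geomSq c) = geomSq (c * t ^ 2) := by
  ext N
  simp only [coeff_rescale, coeff_geomSq]
  split_ifs with h
  · obtain ⟨k, rfl⟩ := h
    have e1 : (k + k) / 2 = k := by omega
    rw [e1, mul_pow, ← pow_mul, show 2 * k = k + k by ring]
    ring
  · rw [mul_zero]

end GeomSq

variable {𝕜 : Type*} [NormedField 𝕜] [CompleteSpace 𝕜]

omit [CompleteSpace 𝕜] in
/-- `∑_m c^m T^{2m}` has absolutely summable coefficients with sum `(1 - c)⁻¹` when `‖c‖ < 1`.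
[folklore] -/
theorem summable_norm_coeff_geomSq_and_hasSum {c : 𝕜} (hc : ‖c‖ < 1) :
    (Summable fun N => ‖coeff N (geomSq c)‖) ∧
      HasSum (fun N => coeff N (geomSq c)) (1 - c)⁻¹ := by
  have hinj : Function.Injective fun m : ℕ => 2 * m := fun a b h => by simpa using h
  have hoff : ∀ N ∉ Set.range (fun m : ℕ => 2 * m), coeff N (geomSq c) = 0 := by
    intro N hN
    rw [coeff_geomSq, if_neg]
    rintro ⟨k, rfl⟩
    exact hN ⟨k, by simp [two_mul]⟩
  have hcomp : (fun N => coeff N (geomSq c)) ∘ (fun m : ℕ => 2 * m) = fun m => c ^ m := by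
    funext m
    simp only [Function.comp_apply, coeff_geomSq, even_two_mul, if_true]
    congr 1
    omega
  constructor
  · have hoff' : ∀ N ∉ Set.range (fun m : ℕ => 2 * m), ‖coeff N (geomSq c)‖ = 0 := fun N hN => by
      rw [hoff N hN, norm_zero]
    refine (hinj.summable_iff hoff').mp ?_
    have : (fun N => ‖coeff N (geomSq c)‖) ∘ (fun m : ℕ => 2 * m) = fun m => ‖c‖ ^ m := by
      funext m
      have := congrFun hcomp m
      simp only [Function.comp_apply] at this ⊢
      rw [this, norm_pow]
    rw [this]
    exact summable_geometric_of_lt_one (norm_nonneg _) hc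
  · refine (hinj.hasSum_iff hoff).mp ?_
    rw [hcomp]
    exact hasSum_geometric_of_norm_lt_one hc

/-- The constant series `1` has absolutely summable coefficients with sum `1`. [folklore] -/
theorem summable_norm_coeff_one_and_hasSum :
    (Summable fun N => ‖coeff N (1 : 𝕜⟦X⟧)‖) ∧ HasSum (fun N => coeff N (1 : 𝕜⟦X⟧)) 1 := by
  classical
  have h := summable_norm_coeff_prod_and_hasSum (𝕜 := 𝕜) (∅ : Finset Unit) (fun _ => 1)
    (fun _ => 1) (by simp) (by simp)
  simpa using h

/-- `L_x(T) = ∏_i (∑_m x_i^m T^m) · ∏_{i<j} (∑_m (x_i x_j)^m T^{2m})` in `R⟦T⟧`: the Littlewood series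
is the product of the geometric series inverse to the factors of `Λ_x`. [folklore] -/
theorem littlewoodSeries_eq_prod_geom {R : Type*} [CommRing R] {n : ℕ} (x : Fin n → R) :
    littlewoodSeries x =
      (∏ i, geom (x i)) * ∏ i, ∏ j, if i < j then geomSq (x i * x j) else 1 := by
  have h1 : littlewoodProd x *
      ((∏ i, geom (x i)) * ∏ i, ∏ j, if i < j then geomSq (x i * x j) else 1) = 1 := by
    unfold littlewoodProd
    rw [mul_mul_mul_comm, ← Finset.prod_mul_distrib, ← Finset.prod_mul_distrib]
    have e1 : ∏ i, ((1 - C (x i) * X) * geom (x i)) = 1 :=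
      Finset.prod_eq_one fun i _ => by rw [mul_comm, geom_mul_one_sub]
    have e2 : ∏ i, ((∏ j, if i < j then (1 - C (x i * x j) * X ^ 2) else 1) *
        ∏ j, if i < j then geomSq (x i * x j) else 1) = 1 := by
      refine Finset.prod_eq_one fun i _ => ?_
      rw [← Finset.prod_mul_distrib]
      refine Finset.prod_eq_one fun j _ => ?_
      split_ifs
      · rw [mul_comm, geomSq_mul_one_sub]
      · rw [mul_one]
    rw [e1, e2, mul_one]
  calc littlewoodSeries x = littlewoodSeries x * (littlewoodProd x *
        ((∏ i, geom (x i)) * ∏ i, ∏ j, if i < j then geomSq (x i * x j) else 1)) := by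
        rw [h1, mul_one]
    _ = (∏ i, geom (x i)) * ∏ i, ∏ j, if i < j then geomSq (x i * x j) else 1 := by
        rw [← mul_assoc, littlewoodSeries_mul_littlewoodProd, one_mul]

/-- `[T^N] L_x · t^N = [T^N] (∏_i ∑_m (x_i t)^m T^m · ∏_{i<j} ∑_m (x_i x_j t²)^m T^{2m})`.
[folklore] -/
theorem coeff_littlewoodSeries_mul_pow {R : Type*} [CommRing R] {n : ℕ} (x : Fin n → R) (t : R)
    (N : ℕ) :
    coeff N (littlewoodSeries x) * t ^ N =
      coeff N ((∏ i, geom (x i * t)) *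
        ∏ p : Fin n × Fin n, if p.1 < p.2 then geomSq (x p.1 * x p.2 * t ^ 2) else 1) := by
  rw [mul_comm, ← coeff_rescale, littlewoodSeries_eq_prod_geom, map_mul, map_prod, map_prod,
    ← Finset.univ_product_univ, Finset.prod_product]
  simp_rw [map_prod, rescale_geom]
  congr 3
  funext i
  refine Finset.prod_congr rfl fun j _ => ?_
  split_ifs
  · exact rescale_geomSq _ _
  · exact map_one _

/-- The coefficient series of `∏_i geom(x_i t) · ∏_{i<j} geomSq(x_i x_j t²)` is absolutely
summable with sum `∏_i (1 - x_i t)⁻¹ ∏_{i<j} (1 - x_i x_j t²)⁻¹` when `‖x_i t‖ < 1`. [folklore] -/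
theorem summable_norm_coeff_littlewoodGeom_and_hasSum {n : ℕ} (x : Fin n → 𝕜) {t : 𝕜}
    (ht : ∀ i, ‖x i * t‖ < 1) :
    (Summable fun N => ‖coeff N ((∏ i, geom (x i * t)) *
        ∏ p : Fin n × Fin n, if p.1 < p.2 then geomSq (x p.1 * x p.2 * t ^ 2) else 1)‖) ∧
      HasSum (fun N => coeff N ((∏ i, geom (x i * t)) *
        ∏ p : Fin n × Fin n, if p.1 < p.2 then geomSq (x p.1 * x p.2 * t ^ 2) else 1))
        ((∏ i, (1 - x i * t)⁻¹) *
          ∏ p : Fin n × Fin n, if p.1 < p.2 then (1 - x p.1 * x p.2 * t ^ 2)⁻¹ else 1) := by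
  classical
  have ht2 : ∀ i j, ‖x i * x j * t ^ 2‖ < 1 := fun i j => by
    rw [show x i * x j * t ^ 2 = (x i * t) * (x j * t) by ring, norm_mul]
    exact mul_lt_one_of_nonneg_of_lt_one_left (norm_nonneg _) (ht i) (ht j).le
  have hA := summable_norm_coeff_prod_and_hasSum (univ : Finset (Fin n))
    (fun i => geom (x i * t)) (fun i => (1 - x i * t)⁻¹)
    (fun i _ => (summable_norm_coeff_geom_and_hasSum (ht i)).1)
    (fun i _ => (summable_norm_coeff_geom_and_hasSum (ht i)).2)
  have hB := summable_norm_coeff_prod_and_hasSum (univ : Finset (Fin n × Fin n))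
    (fun p => if p.1 < p.2 then geomSq (x p.1 * x p.2 * t ^ 2) else 1)
    (fun p => if p.1 < p.2 then (1 - x p.1 * x p.2 * t ^ 2)⁻¹ else 1)
    (fun p _ => by
      by_cases hp : p.1 < p.2
      · simp only [hp, if_true]
        exact (summable_norm_coeff_geomSq_and_hasSum (ht2 p.1 p.2)).1
      · simp only [hp, if_false]
        exact summable_norm_coeff_one_and_hasSum.1)
    (fun p _ => by
      by_cases hp : p.1 < p.2
      · simp only [hp, if_true]
        exact (summable_norm_coeff_geomSq_and_hasSum (ht2 p.1 p.2)).2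
      · simp only [hp, if_false]
        exact summable_norm_coeff_one_and_hasSum.2)
  -- combine the two factors (a product over `Bool`)
  set F : Bool → 𝕜⟦X⟧ := fun b => if b then ∏ i, geom (x i * t) else
      ∏ p : Fin n × Fin n, if p.1 < p.2 then geomSq (x p.1 * x p.2 * t ^ 2) else 1 with hF
  set a : Bool → 𝕜 := fun b => if b then ∏ i, (1 - x i * t)⁻¹ else
      ∏ p : Fin n × Fin n, if p.1 < p.2 then (1 - x p.1 * x p.2 * t ^ 2)⁻¹ else 1 with ha
  have hC := summable_norm_coeff_prod_and_hasSum (univ : Finset Bool) F a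
    (fun b _ => by cases b <;> simp only [hF] <;> first | exact hB.1 | exact hA.1)
    (fun b _ => by cases b <;> simp only [hF, ha] <;> first | exact hB.2 | exact hA.2)
  simp only [hF, ha, Fintype.prod_bool, if_true] at hC
  exact hC

/-- **Littlewood's identity, analytic form.** For `x ∈ 𝕜ⁿ` and `t ∈ 𝕜` with `‖x_i t‖ < 1` for
all `i` (`𝕜` a complete normed field), `∑_N (∑_{λ antitone, |λ| = N} s_λ(x)) t^N` converges
(absolutely) to `∏_i (1 - x_i t)⁻¹ ∏_{i<j} (1 - x_i x_j t²)⁻¹` (Macdonald 1995, Ch. I §5 Ex. 4, at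
a point). [cite: Macdonald1995, Ch. I §5 Ex. 4] -/
theorem hasSum_coeff_littlewoodSeries_mul_pow {n : ℕ} (x : Fin n → 𝕜) {t : 𝕜}
    (ht : ∀ i, ‖x i * t‖ < 1) :
    HasSum (fun N => coeff N (littlewoodSeries x) * t ^ N)
      ((∏ i, (1 - x i * t)⁻¹) * ∏ i, ∏ j, if i < j then (1 - x i * x j * t ^ 2)⁻¹ else 1) := by
  simp_rw [coeff_littlewoodSeries_mul_pow]
  have e : (∏ i, ∏ j, if i < j then (1 - x i * x j * t ^ 2)⁻¹ else (1 : 𝕜)) =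
      ∏ p : Fin n × Fin n, if p.1 < p.2 then (1 - x p.1 * x p.2 * t ^ 2)⁻¹ else 1 := by
    rw [← Finset.univ_product_univ, Finset.prod_product]
  rw [e]
  exact (summable_norm_coeff_littlewoodGeom_and_hasSum x ht).2

/-- Absolute convergence in `hasSum_coeff_littlewoodSeries_mul_pow`. [folklore] -/
theorem summable_norm_coeff_littlewoodSeries_mul_pow {n : ℕ} (x : Fin n → 𝕜) {t : 𝕜}
    (ht : ∀ i, ‖x i * t‖ < 1) :
    Summable fun N => ‖coeff N (littlewoodSeries x) * t ^ N‖ := by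
  simp_rw [coeff_littlewoodSeries_mul_pow]
  exact (summable_norm_coeff_littlewoodGeom_and_hasSum x ht).1

/-- The generating series of a solution `w` of the dual Pieri recursions is `w(0) L_x(T)`.
[folklore] -/
theorem mk_sum_eq_C_mul_littlewoodSeries {R : Type*} [CommRing R] {n : ℕ} (x : Fin n → R)
    (w : (Fin n → ℕ) → R)
    (h0 : ∀ ν, ¬ Antitone ν → w ν = 0)
    (hrec : ∀ la, Antitone la → ∀ r, 1 ≤ r → r ≤ n →
      esymm x r * w la = ∑ S ∈ powersetCard r univ, w (addOn S la)) :
    (PowerSeries.mk fun N => ∑ m ∈ piAntidiag univ N, w m) = C (w 0) * littlewoodSeries x := by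
  calc (PowerSeries.mk fun N => ∑ m ∈ piAntidiag univ N, w m)
      = (PowerSeries.mk fun N => ∑ m ∈ piAntidiag univ N, w m) *
          (littlewoodSeries x * littlewoodProd x) := by
        rw [littlewoodSeries_mul_littlewoodProd, mul_one]
    _ = C (w 0) * littlewoodSeries x := by
        rw [mul_comm (littlewoodSeries x), ← mul_assoc, mk_sum_mul_littlewoodProd x w h0 hrec]

/-- **The unramified Asai (twisted tensor) torus sum, analytic form.** For a solution `w` of the
dual Pieri recursions for `x ∈ 𝕜ⁿ` (vanishing off the antitone weights) and `t ∈ 𝕜` with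
`‖x_i t‖ < 1`: `∑_N (∑_{|m| = N} w(m)) t^N = w(0) ∏_i (1 - x_i t)⁻¹ ∏_{i<j} (1 - x_i x_j t²)⁻¹`,
the series converging absolutely. With `x` the Satake parameters of the unramified `π_w` on
`GL_n(E_w)` (`w` the place of `E` over a place `v` of `F` inert and unramified in `E/F`,
`q_w = q_v²`), `t = q_v^{-s}` and `w(λ) = W(ϖ^λ) q_v^{b_n(λ)}` the spherical Whittaker function
on the torus times the `GL_n(F_v)`-Iwasawa Jacobian (`= s_λ(x) W(1)` by Shintani's formula,
since `δ_{E_w} = δ_{F_v}²` on `A(F_v)`), this is Flicker's `Ψ(s, Φ°, W°) = W°(1) ∏_i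
(1 - z_i q_v^{-s})⁻¹ ∏_{j<k} (1 - z_j z_k q_v^{-2s})⁻¹ = W°(1) L(s, r(π_v))` (Flicker 1988, §3
Proposition, inert case, p. 306) once the `p`-adic integral has been unfolded to the torus sum.
[cite: Flicker1988, §3 Proposition] -/
theorem hasSum_littlewoodPieri {n : ℕ} (x : Fin n → 𝕜) (w : (Fin n → ℕ) → 𝕜)
    (h0 : ∀ ν, ¬ Antitone ν → w ν = 0)
    (hrec : ∀ la, Antitone la → ∀ r, 1 ≤ r → r ≤ n →
      esymm x r * w la = ∑ S ∈ powersetCard r univ, w (addOn S la))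
    {t : 𝕜} (ht : ∀ i, ‖x i * t‖ < 1) :
    HasSum (fun N => (∑ m ∈ piAntidiag univ N, w m) * t ^ N)
      (w 0 * ((∏ i, (1 - x i * t)⁻¹) *
        ∏ i, ∏ j, if i < j then (1 - x i * x j * t ^ 2)⁻¹ else 1)) := by
  have h := (hasSum_coeff_littlewoodSeries_mul_pow x ht).mul_left (w 0)
  have hfun : (fun N => (∑ m ∈ piAntidiag univ N, w m) * t ^ N) =
      fun N => w 0 * (coeff N (littlewoodSeries x) * t ^ N) := by
    funext N
    have := congrArg (coeff N) (mk_sum_eq_C_mul_littlewoodSeries x w h0 hrec)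
    rw [coeff_mk, PowerSeries.coeff_C_mul] at this
    rw [this, mul_assoc]
  rw [hfun]
  exact h

/-- Absolute convergence in `hasSum_littlewoodPieri`. [folklore] -/
theorem summable_norm_littlewoodPieri {n : ℕ} (x : Fin n → 𝕜) (w : (Fin n → ℕ) → 𝕜)
    (h0 : ∀ ν, ¬ Antitone ν → w ν = 0)
    (hrec : ∀ la, Antitone la → ∀ r, 1 ≤ r → r ≤ n →
      esymm x r * w la = ∑ S ∈ powersetCard r univ, w (addOn S la))
    {t : 𝕜} (ht : ∀ i, ‖x i * t‖ < 1) :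
    Summable fun N => ‖(∑ m ∈ piAntidiag univ N, w m) * t ^ N‖ := by
  have h := (summable_norm_coeff_littlewoodSeries_mul_pow x ht).mul_left ‖w 0‖
  refine h.of_nonneg_of_le (fun N => norm_nonneg _) fun N => ?_
  have := congrArg (coeff N) (mk_sum_eq_C_mul_littlewoodSeries x w h0 hrec)
  rw [coeff_mk, PowerSeries.coeff_C_mul] at this
  rw [this, mul_assoc, norm_mul]

end Literature.RingTheory.SymmetricFunctions.SymmPoly
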